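import Summits.QuantumFields.BalabanUV.T4Continuum.Support.SubstrateFineFieldChart
import Summits.QuantumFields.BalabanUV.T4Continuum.Support.SubstrateComplexAvgTowerDisc
import Literature.MathematicalPhysics.QuantumFieldTheory.Balaban1983to89.T4AdjointCovarianceUnitary

/-!
# SUBSTRATE — W-24d = LIBRARY L-E18b PART 3, FILE 1∕2 (typer (π1) l.23183, (π3) l.23334, (π4) l.23452, NEXT.md gen 14): W-22′'s `FineFieldChart`
# INHABITED BY THE COMPLEX (0.4) AVERAGING TOWERS — the slice coordinate IS W-24c-α's tower chart coordinate `towerCoord` of the fine-field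
# slice `z ↦ exp(zH)·U`; letters (1) centre, (4) real tie, (5) reach PROVED; letters (2′) holomorphy and (3) depth PROVED FROM three DISPLAYED
# conditions along the closed unit disc in α's currency (`SliceControl` — DISCHARGED after rescaling the direction in FILE 2
# `SubstrateFineFieldChartSUWindow`); at a general unitary `ι`, and at `ℰ := expMeanLogSU`, `ι := fundamentalRep n`

Cell `pub-balaban`, SUBSTRATE cell, seat `b2b-balaban-substrate-p2` (gen 6).  Summits-side under the LEAN PLACEMENT RULE; [folklore] throughout: finite
products of matrices, `NormedSpace.exp`, the tree's `mlog` chart (W-24a `SubstrateExpChartLog`), the complex block average and its tower (W-24b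
`SubstrateComplexBlockAvg`, W-24c-α `SubstrateComplexBlockAvgInv` ∕ `SubstrateComplexAvgTower` (p1 g7), W-24c-β `SubstrateComplexAvgTowerDisc` (p4 g5)) and
W-22′'s interface `SubstrateFineFieldChart` BY NAME; nothing printed in [Balaban1985Averaging] ∕ [Balaban1987RG1] is asserted beyond what those modules
PROVE; no citation tags.  HONEST FRAMING: rung (B)+1 of the FINITE-VOLUME T⁴ programme — NOT infinite volume, NOT a mass gap, NOT Clay; spine PROVED
0∕9.  A CONSTRUCTION of an inhabitant of an interface (typer (π8-2) (ψ4), verbatim): the disc depth is EXISTENTIAL by continuity at the real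
point (FILE 2) — NOT the (0.4)–(0.7)-kind quantitative radius; levelwise `Small` DEFINES the window, no field is claimed small; NO estimate of any
NE row.

WHAT IS HERE.  §0 `SliceControl ℰ ι U H ϱ` (DISPLAYED along the closed unit disc: two-orientation `ℰ.δ`-smallness of the iterated loop variables of the
slice data — `loop`; the log window of the slice's `R`-tower at the tower of record — `window`; the depth `‖towerCoord … z‖ < ϱ k` — `depth`);
**`analyticAt_towerCoord`** AT EVERY POINT of the window (α `analyticAt_iterRS` along W-24b's entire slice ∘ W-24a `analyticAt_logChartT_comp`; α has the
point `z = 0`); `diffContOnCl_towerCoord` (2′), `mapsTo_towerCoord` (3); `SliceControl.of_prox` (sup-norm proximity `≤ η ≤ 1∕2`, `2η < ϱ k` ⇒ window +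
depth: W-24a `mem_logWindow_of_norm_sub_lt_one`, β `norm_towerCoord_le_two_mul`).  §1 (road D, `havB : D.avB = fun _ => blockAvg ℰ`, `rfl` at
`DrivenRuns.balaban`) `towerB_eq_towerDataOf`; the READING POINTS `SlicePoint D Wreg dirs r` (centre in the window, admissible direction, parameter of
modulus `≤ r`) read by `SlicePoint.emb` := the chart point of the slice.  §2 **`FineFieldChart.ofSlices`** — THE INHABITANT at a general unitary `ι`
(α's `hδ hι hdist hE`): (1) ← α `towerCoord_zero`; (2′)(3) ← §0; (4) ← α `expChartT_towerCoord` + `towerRS_hom_eq_fst` from the DISPLAYED move closure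
`hmove` and levelwise smallness `hWsmall` of the window; (5) `rfl`; **`ofSlices_family_uC ∕ _uCinv`** — W-22′'s chart family READS α's two towers
`(towerSlice … z).1 ∕ .2` on the closed disc.  §3 (`SU(n)`, `fundamentalRep n`, `expMeanLogSU`) `smul_mem_lieSU`, the REAL MOVE `moveSU` (tree
`exp_mem_specialUnitaryGroup_of_mem_lieSU`), `sliceR_moveSU` ∕ `sliceS_moveSU`, **`FineFieldChart.ofSlicesSU`** (representation side DISCHARGED: α
`expMeanLogSU_δ_le_third`, tree `fundamentalRep_mem_unitaryGroup`, `rfl`, W-24b `fundamentalRep_expMeanLogSU_E`).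

X-READ PLAN. (P0) `towerB_eq_towerDataOf`, `coe_moveSU`, `reach` are `rfl`∕one rewrite.  (K) drop `hWsmall` ⇒ `slice_zero` unprovable; drop `window` ⇒
`real`, `ofSlices_family_uC` break; weaken `loop` to `≤ 1` ⇒ `ofSlices_family_uCinv` breaks.  0 sorry; axioms ⊆ {propext, Classical.choice, Quot.sound}.
-/

noncomputable section

open scoped Matrix.Norms.L2Operator BigOperators
open Set Metric

namespace Summit.QuantumFields.BalabanUV.T4Continuum.SubstrateFineFieldChartSU

open Literature.MathematicalPhysics.QuantumFieldTheory.Balaban1983to89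
open Literature.MathematicalPhysics.QuantumFieldTheory.Balaban1983to89.BlockAveraging (blockAvg Small)
open Literature.MathematicalPhysics.QuantumFieldTheory.Balaban1983to89.ExpMeanLog (eml expMeanLogSU)
open Literature.MathematicalPhysics.QuantumFieldTheory.Balaban1983to89.B5Prop11Plancherel (Tor fine)
open Literature.MathematicalPhysics.QuantumFieldTheory.Balaban1983to89.B5G183RateUnitTower (lev)
open Literature.MathematicalPhysics.QuantumFieldTheory.Balaban1983to89.T4AdjointCovarianceUnitary (lieSU mem_lieSU_iff
  exp_mem_specialUnitaryGroup_of_mem_lieSU)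
open Literature.MathematicalPhysics.QuantumLattice (fundamentalRep fundamentalRep_apply fundamentalRep_mem_unitaryGroup)
open Summit.QuantumFields.BalabanUV.T4Continuum
open Summit.QuantumFields.BalabanUV.T4Continuum.SubstrateBackgroundTransporters (unitMod)
open Summit.QuantumFields.BalabanUV.T4Continuum.SubstrateTransporterSpecies (TowerData towerDataOf)
open Summit.QuantumFields.BalabanUV.T4Continuum.SubstrateTransporterSpeciesHolo (expChartT expChartInvT)
open Summit.QuantumFields.BalabanUV.T4Continuum.SubstrateExpChartLog (logChartT analyticAt_logChartT_comp mem_logWindow_of_norm_sub_lt_one)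
open Summit.QuantumFields.BalabanUV.T4Continuum.SubstrateChartSection (TwoRunChart)
open Summit.QuantumFields.BalabanUV.T4Continuum.SubstrateTwoRunsDriven (DrivenRuns)
open Summit.QuantumFields.BalabanUV.T4Continuum.SubstrateFineFieldChart (towerB chartAt FineFieldChart)
open Summit.QuantumFields.BalabanUV.T4Continuum.SubstrateComplexBlockAvg
open Summit.QuantumFields.BalabanUV.T4Continuum.SubstrateComplexBlockAvgInv
open Summit.QuantumFields.BalabanUV.T4Continuum.SubstrateComplexAvgTower
open Summit.QuantumFields.BalabanUV.T4Continuum.SubstrateComplexAvgTowerDisc (norm_towerCoord_le_two_mul)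

/-! ## §0 The displayed conditions along the closed unit disc; holomorphy and depth of the tower coordinate from them -/

section Control

variable {P : Params} {o : Type*} [Fintype o] [DecidableEq o] {G : Type*} [GaugeGroup G]

/-- [folklore] The tower of record of a field has unitary entries when `ι` is unitary-valued. -/
theorem towerDataOf_mem_unitaryGroup (ℰ : LoopAverage G) {ι : G →* Matrix o o ℂ} (hι : ∀ g, ι g ∈ Matrix.unitaryGroup o ℂ) (U : GaugeField P 0 G)
    (k : Fin (P.K + 1)) (ν : Fin P.d) (i : Tor (fine (lev P.L k) (unitMod P)) × Fin P.d) :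
    towerDataOf P ι (fun _ => blockAvg ℰ) U k ν i ∈ Matrix.unitaryGroup o ℂ := by
  rw [towerDataOf, SubstrateBackgroundTransporters.transV_apply]; exact hι _

/-- [folklore] **THE DISPLAYED CONDITIONS ALONG THE CLOSED UNIT DISC** of the fine-field slice `z ↦ (exp(zH)·ι U, ι U⁻¹·exp(−zH))` at centre `U`,
direction `H`, radii `ϱ k` (α's currency): (`loop`) the iterated loop variables of the slice data are `ℰ.δ`-small (`Small`-strength) in BOTH
orientations at every coarse bond of every level `< K`; (`window`) the `R`-tower of the slice lies in the log window of the tower of record of `U`;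
(`depth`) the tower chart coordinate has sup norm `< ϱ k`.  A hypothesis PACKAGE (a parametric shape on data, not a fact). -/
@[folklore]
structure SliceControl (ℰ : LoopAverage G) (ι : G →* Matrix o o ℂ) (U : GaugeField P 0 G) (H : PBond P 0 → Matrix o o ℂ) (ϱ : ℕ → ℝ) : Prop where
  /-- two-orientation `ℰ.δ`-smallness of the iterated loop variables along the closed disc -/
  loop : ∀ z ∈ closedBall (0 : ℂ) 1, ∀ j < P.K, ∀ c i,
    ‖loopHolRS (iterRS j (sliceR ι U H z, sliceS ι U H z)).1 (iterRS j (sliceR ι U H z, sliceS ι U H z)).2 c i - 1‖ < ℰ.δ ∧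
      ‖loopHolSR (iterRS j (sliceR ι U H z, sliceS ι U H z)).1 (iterRS j (sliceR ι U H z, sliceS ι U H z)).2 c i - 1‖ < ℰ.δ
  /-- the `R`-tower of the slice stays in the log window of the tower of record along the closed disc -/
  window : ∀ z ∈ closedBall (0 : ℂ) 1, ∀ (k : Fin (P.K + 1)) ν i,
    ‖(towerSlice P ι U H z).1 k ν i * (towerDataOf P ι (fun _ => blockAvg ℰ) U k ν i)⁻¹ - 1‖ < 1
  /-- the depth: the tower chart coordinate of the closed disc lies in the coordinate ball of radius `ϱ k`, every `k` -/
  depth : ∀ (k : ℕ), ∀ z ∈ closedBall (0 : ℂ) 1, ‖towerCoord P ℰ ι U H z‖ < ϱ k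

/-- [folklore] **THE `R`-TOWER OF THE SLICE IS HOLOMORPHIC at every parameter whose iterated loop variables are 1-small in both orientations**
(α `analyticAt_iterRS` along W-24b's entire slice `analyticAt_sliceR ∕ analyticAt_sliceS`, read in the charts). -/
theorem analyticAt_towerSlice_fst (ι : G →* Matrix o o ℂ) (U : GaugeField P 0 G) (H : PBond P 0 → Matrix o o ℂ) {z : ℂ}
    (hloop : ∀ j < P.K, ∀ c i,
      ‖loopHolRS (iterRS j (sliceR ι U H z, sliceS ι U H z)).1 (iterRS j (sliceR ι U H z, sliceS ι U H z)).2 c i - 1‖ < 1 ∧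
        ‖loopHolSR (iterRS j (sliceR ι U H z, sliceS ι U H z)).1 (iterRS j (sliceR ι U H z, sliceS ι U H z)).2 c i - 1‖ < 1) :
    AnalyticAt ℂ (fun w => (towerSlice P ι U H w).1) z :=
  analyticAt_pi_iff.2 fun k => analyticAt_pi_iff.2 fun _ => analyticAt_pi_iff.2 fun _ =>
    (analyticAt_iterRS (R := fun w => sliceR ι U H w) (S := fun w => sliceS ι U H w) (fun b => analyticAt_sliceR ι U H z b)
      (fun b => analyticAt_sliceS ι U H z b) (P.K - k) fun j hj => hloop j (by omega)).1 _

/-- [folklore] **THE TOWER CHART COORDINATE IS HOLOMORPHIC AT EVERY POINT OF THE WINDOW** with 1-small loop variables (W-24a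
`analyticAt_logChartT_comp` ∘ `analyticAt_towerSlice_fst`) — the general-point companion of α's `analyticAt_towerCoord_zero`. -/
theorem analyticAt_towerCoord (ℰ : LoopAverage G) (ι : G →* Matrix o o ℂ) (U : GaugeField P 0 G) (H : PBond P 0 → Matrix o o ℂ) {z : ℂ}
    (hloop : ∀ j < P.K, ∀ c i,
      ‖loopHolRS (iterRS j (sliceR ι U H z, sliceS ι U H z)).1 (iterRS j (sliceR ι U H z, sliceS ι U H z)).2 c i - 1‖ < 1 ∧
        ‖loopHolSR (iterRS j (sliceR ι U H z, sliceS ι U H z)).1 (iterRS j (sliceR ι U H z, sliceS ι U H z)).2 c i - 1‖ < 1)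
    (hwin : ∀ (k : Fin (P.K + 1)) ν i, ‖(towerSlice P ι U H z).1 k ν i * (towerDataOf P ι (fun _ => blockAvg ℰ) U k ν i)⁻¹ - 1‖ < 1) :
    AnalyticAt ℂ (towerCoord P ℰ ι U H) z :=
  analyticAt_logChartT_comp P (analyticAt_towerSlice_fst ι U H hloop) hwin

namespace SliceControl

variable {ℰ : LoopAverage G} {ι : G →* Matrix o o ℂ} {U : GaugeField P 0 G} {H : PBond P 0 → Matrix o o ℂ} {ϱ : ℕ → ℝ}
variable (hc : SliceControl ℰ ι U H ϱ)
include hc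

/-- [folklore] With `ℰ.δ ≤ 1∕3`: the `loop` condition in the `1∕3` form α's inverse invariant takes and the `1` form holomorphy takes. -/
theorem loop_le {z : ℂ} (hδ : ℰ.δ ≤ 1 / 3) (hz : z ∈ closedBall (0 : ℂ) 1) (j : ℕ) (hj : j < P.K) (c : PBond P (j + 1))
    (i : BlockAveraging.Idx P) :
    (‖loopHolRS (iterRS j (sliceR ι U H z, sliceS ι U H z)).1 (iterRS j (sliceR ι U H z, sliceS ι U H z)).2 c i - 1‖ ≤ 1 / 3 ∧
      ‖loopHolRS (iterRS j (sliceR ι U H z, sliceS ι U H z)).1 (iterRS j (sliceR ι U H z, sliceS ι U H z)).2 c i - 1‖ < 1) ∧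
      ‖loopHolSR (iterRS j (sliceR ι U H z, sliceS ι U H z)).1 (iterRS j (sliceR ι U H z, sliceS ι U H z)).2 c i - 1‖ < 1 :=
  ⟨⟨((hc.loop z hz j hj c i).1.le.trans hδ), (hc.loop z hz j hj c i).1.trans_le (hδ.trans (by norm_num))⟩,
    (hc.loop z hz j hj c i).2.trans_le (hδ.trans (by norm_num))⟩

/-- [folklore] **LETTER (2′) FROM THE DISPLAYED CONDITIONS**: the tower chart coordinate is holomorphic on the open unit disc and continuous on
its closure (it is analytic at every point of the closed disc). -/
theorem diffContOnCl_towerCoord (hδ : ℰ.δ ≤ 1 / 3) : DiffContOnCl ℂ (towerCoord P ℰ ι U H) (ball (0 : ℂ) 1) := by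
  refine DifferentiableOn.diffContOnCl ?_
  rw [closure_ball (0 : ℂ) one_ne_zero]
  exact fun z hz => (analyticAt_towerCoord ℰ ι U H (fun j hj c i => ⟨(hc.loop_le hδ hz j hj c i).1.2, (hc.loop_le hδ hz j hj c i).2⟩)
    (hc.window z hz)).differentiableAt.differentiableWithinAt

/-- [folklore] **LETTER (3) FROM THE DISPLAYED CONDITIONS**: the closed unit disc charts into the coordinate ball of radius `ϱ k`. -/
theorem mapsTo_towerCoord (k : ℕ) : MapsTo (towerCoord P ℰ ι U H) (closedBall (0 : ℂ) 1) (ball 0 (ϱ k)) :=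
  fun z hz => mem_ball_zero_iff.2 (hc.depth k z hz)

end SliceControl

/-- [folklore] **PROXIMITY GIVES THE WINDOW AND THE DEPTH**: at a unitary-valued `ι`, if along the closed disc the `R`-tower of the slice stays
`η`-close in sup norm to the tower of record, `η ≤ 1∕2` and `2η < ϱ k` for every `k`, then (with the loop condition) `SliceControl` holds (W-24a
`mem_logWindow_of_norm_sub_lt_one`, β `norm_towerCoord_le_two_mul`). -/
theorem SliceControl.of_prox {ℰ : LoopAverage G} {ι : G →* Matrix o o ℂ} (hι : ∀ g, ι g ∈ Matrix.unitaryGroup o ℂ) {U : GaugeField P 0 G}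
    {H : PBond P 0 → Matrix o o ℂ} {ϱ : ℕ → ℝ} {η : ℝ} (hη : η ≤ 1 / 2) (hϱ : ∀ k, 2 * η < ϱ k)
    (hloop : ∀ z ∈ closedBall (0 : ℂ) 1, ∀ j < P.K, ∀ c i,
      ‖loopHolRS (iterRS j (sliceR ι U H z, sliceS ι U H z)).1 (iterRS j (sliceR ι U H z, sliceS ι U H z)).2 c i - 1‖ < ℰ.δ ∧
        ‖loopHolSR (iterRS j (sliceR ι U H z, sliceS ι U H z)).1 (iterRS j (sliceR ι U H z, sliceS ι U H z)).2 c i - 1‖ < ℰ.δ)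
    (hprox : ∀ z ∈ closedBall (0 : ℂ) 1, ‖(towerSlice P ι U H z).1 - towerDataOf P ι (fun _ => blockAvg ℰ) U‖ ≤ η) :
    SliceControl ℰ ι U H ϱ where
  loop := hloop
  window z hz := mem_logWindow_of_norm_sub_lt_one P (towerDataOf_mem_unitaryGroup ℰ hι U) ((hprox z hz).trans_lt (by linarith))
  depth k z hz := (norm_towerCoord_le_two_mul P ℰ ι hι U H ((hprox z hz).trans hη)).trans_lt (by linarith [hprox z hz, hϱ k])

end Control

/-! ## §1 Road D: the centre tower of W-22′ is α's tower of record; the reading points -/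

section Road

variable {G : Type} [GaugeGroup G] (D : DrivenRuns G) {o : Type} [Fintype o] [DecidableEq o] (ι : G →* Matrix o o ℂ) (ℰ : LoopAverage G)

/-- [folklore] **THE BRIDGE**: when run B averages by `blockAvg ℰ` at every level (`havB`; `rfl` for `DrivenRuns.balaban`), W-22′'s centre tower
`towerB D ι b` IS α's tower of record `towerDataOf _ ι (fun _ => blockAvg ℰ) b.1`. -/
theorem towerB_eq_towerDataOf (havB : D.avB = fun _ => blockAvg ℰ) (b : D.carriers.BgB) :
    towerB D ι b = towerDataOf (D.F.P (D.K + 1)) ι (fun _ => blockAvg ℰ) b.1 := by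
  rw [towerB, havB]

/-- [folklore] **THE READING POINTS OF THE CHART**: a centre in the window `Wreg`, an admissible direction at it (`dirs`), a parameter of modulus at
most the depth `r` — the points of the two-run chart REACHED by the slices (letter (5) by construction). -/
structure SlicePoint (Wreg : Set D.carriers.BgB) (dirs : D.carriers.BgB → Set (PBond (D.F.P (D.K + 1)) 0 → Matrix o o ℂ)) (r : ℝ) where
  /-- the real centre -/
  ctr : D.carriers.BgB
  /-- … in the window -/
  ctr_mem : ctr ∈ Wreg
  /-- the direction of the slice -/
  dir : PBond (D.F.P (D.K + 1)) 0 → Matrix o o ℂ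
  /-- … admissible at the centre -/
  dir_mem : dir ∈ dirs ctr
  /-- the parameter at which the point is read -/
  param : ℂ
  /-- … of modulus at most the depth -/
  norm_param_le : ‖param‖ ≤ r

variable {Wreg : Set D.carriers.BgB} {dirs : D.carriers.BgB → Set (PBond (D.F.P (D.K + 1)) 0 → Matrix o o ℂ)} {r : ℝ}

/-- [folklore] **THE READING**: the chart point of the slice through the centre in the direction at the parameter. -/
def SlicePoint.emb (u : SlicePoint D Wreg dirs r) : TwoRunChart D o :=
  chartAt D ι u.ctr (towerCoord (D.F.P (D.K + 1)) ℰ ι u.ctr.1 u.dir u.param)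

/-- [folklore] A real parameter of modulus `< 1` lies in the closed unit disc. -/
theorem ofReal_mem_closedBall {x : ℝ} (hx : |x| < 1) : (x : ℂ) ∈ closedBall (0 : ℂ) 1 := by
  rw [mem_closedBall_zero_iff, Complex.norm_real, Real.norm_eq_abs]; exact hx.le

/-! ## §2 The inhabitant at a general unitary `ι` -/

variable {D ι ℰ}

/-- [folklore] **THE FINE-FIELD CHART OF ROAD D INHABITED BY THE COMPLEX (0.4) AVERAGING TOWERS** (L-E18b PART 3).  At a unitary-valued `ι` realising
`dist1` and intertwining `ℰ.E` with `eml` on small words, `ℰ.δ ≤ 1∕3`, run B averaging by `blockAvg ℰ`: over a window `Wreg` of LEVELWISE-SMALL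
fields (`hWsmall`) CLOSED UNDER THE REAL SLICE MOVES of its admissible directions (`hmove`: the slice data at a real `|x| < 1` are the data of a window
field), with `SliceControl` DISPLAYED for every (centre, direction): the slices `towerCoord _ ℰ ι u.ctr u.dir` form a `FineFieldChart` for the reading
points `SlicePoint D Wreg dirs r` — (1) α `towerCoord_zero`, (2′)(3) §0, (4) α `expChartT_towerCoord` + `towerRS_hom_eq_fst`, (5) `rfl`. -/
def FineFieldChart.ofSlices (havB : D.avB = fun _ => blockAvg ℰ) (hδ : ℰ.δ ≤ 1 / 3) (hι : ∀ g, ι g ∈ Matrix.unitaryGroup o ℂ)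
    (hdist : ∀ g : G, ‖ι g - 1‖ = dist1 g)
    (hE : ∀ {m : ℕ} (W : Fin (m + 1) → G), (∀ i, dist1 (W i) < ℰ.δ) → ι (ℰ.E W) = eml fun i => ι (W i))
    {ϱ : ℕ → D.carriers.BgB → ℝ}
    (hWsmall : ∀ U ∈ Wreg, ∀ j < (D.F.P (D.K + 1)).K, ∀ c, Small ℰ (Averaging.iter (fun _ => blockAvg ℰ) j U.1) c)
    (hctl : ∀ U ∈ Wreg, ∀ H ∈ dirs U, SliceControl ℰ ι U.1 H (fun k => ϱ k U))
    (hmove : ∀ U ∈ Wreg, ∀ H ∈ dirs U, ∀ x : ℝ, |x| < 1 → ∃ U' ∈ Wreg,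
      sliceR ι U.1 H (x : ℂ) = (fun b => ι (U'.1 b)) ∧ sliceS ι U.1 H (x : ℂ) = fun b => ι (U'.1 b)⁻¹) :
    FineFieldChart D ι Wreg (SlicePoint D Wreg dirs r) (SlicePoint.emb D ι ℰ) ϱ r where
  ctr _ u := u.ctr
  ctr_mem _ u := u.ctr_mem
  slice _ u := towerCoord (D.F.P (D.K + 1)) ℰ ι u.ctr.1 u.dir
  slice_zero _ u := towerCoord_zero ℰ hδ ι hι hdist hE _ _ (hWsmall _ u.ctr_mem)
  diffContOnCl _ u := (hctl _ u.ctr_mem _ u.dir_mem).diffContOnCl_towerCoord hδ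
  mapsTo k u := (hctl _ u.ctr_mem _ u.dir_mem).mapsTo_towerCoord k
  real _ u x hx := by
    obtain ⟨U', hU', hR, hS⟩ := hmove _ u.ctr_mem _ u.dir_mem x hx
    refine ⟨U', hU', ?_⟩
    show expChartT _ (towerB D ι u.ctr) (towerCoord _ ℰ ι u.ctr.1 u.dir x) = towerB D ι U'
    rw [towerB_eq_towerDataOf D ι ℰ havB, towerB_eq_towerDataOf D ι ℰ havB,
      expChartT_towerCoord ℰ ι hι _ _ _ ((hctl _ u.ctr_mem _ u.dir_mem).window _ (ofReal_mem_closedBall hx)), towerSlice, hR, hS]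
    exact towerRS_hom_eq_fst ℰ hδ ι hdist hE _ (hWsmall _ hU')
  param _ u := u.param
  norm_param_le _ u := u.norm_param_le
  reach _ _ := rfl

section Family

variable (havB : D.avB = fun _ => blockAvg ℰ) (hδ : ℰ.δ ≤ 1 / 3) (hι : ∀ g, ι g ∈ Matrix.unitaryGroup o ℂ)
  (hdist : ∀ g : G, ‖ι g - 1‖ = dist1 g) (hE : ∀ {m : ℕ} (W : Fin (m + 1) → G), (∀ i, dist1 (W i) < ℰ.δ) → ι (ℰ.E W) = eml fun i => ι (W i))
  {ϱ : ℕ → D.carriers.BgB → ℝ} (hWsmall : ∀ U ∈ Wreg, ∀ j < (D.F.P (D.K + 1)).K, ∀ c, Small ℰ (Averaging.iter (fun _ => blockAvg ℰ) j U.1) c)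
  (hctl : ∀ U ∈ Wreg, ∀ H ∈ dirs U, SliceControl ℰ ι U.1 H (fun k => ϱ k U))
  (hmove : ∀ U ∈ Wreg, ∀ H ∈ dirs U, ∀ x : ℝ, |x| < 1 → ∃ U' ∈ Wreg,
    sliceR ι U.1 H (x : ℂ) = (fun b => ι (U'.1 b)) ∧ sliceS ι U.1 H (x : ℂ) = fun b => ι (U'.1 b)⁻¹)

/-- [folklore] **THE CHART FAMILY READS α's `R`-TOWER**: on the closed unit disc, W-22′'s `FineFieldChart.family k u` of the inhabitant has
`uC z = (towerSlice _ ι u.ctr u.dir z).1` (α `expChartT_towerCoord` on the displayed window). -/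
theorem FineFieldChart.ofSlices_family_uC (k : ℕ) (u : SlicePoint D Wreg dirs r) {z : ℂ} (hz : z ∈ closedBall (0 : ℂ) 1) :
    ((FineFieldChart.ofSlices havB hδ hι hdist hE hWsmall hctl hmove).family k u).uC z = (towerSlice (D.F.P (D.K + 1)) ι u.ctr.1 u.dir z).1 := by
  rw [(FineFieldChart.family_uC _ k u z).1]
  show expChartT _ (towerB D ι u.ctr) (towerCoord _ ℰ ι u.ctr.1 u.dir z) = _
  rw [towerB_eq_towerDataOf D ι ℰ havB]
  exact expChartT_towerCoord ℰ ι hι _ _ z ((hctl _ u.ctr_mem _ u.dir_mem).window z hz)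

/-- [folklore] **… AND ITS INVERSE SIDE READS α's `S`-TOWER**: `uCinv z = (towerSlice _ ι u.ctr u.dir z).2` on the closed unit disc (α
`expChartInvT_towerCoord`: window + `1∕3`-smallness) — so the covariance species along the chart (W-22′ §3) ARE the species at the two complex averaging
towers of the slice. -/
theorem FineFieldChart.ofSlices_family_uCinv (k : ℕ) (u : SlicePoint D Wreg dirs r) {z : ℂ} (hz : z ∈ closedBall (0 : ℂ) 1) :
    ((FineFieldChart.ofSlices havB hδ hι hdist hE hWsmall hctl hmove).family k u).uCinv z = (towerSlice (D.F.P (D.K + 1)) ι u.ctr.1 u.dir z).2 := by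
  rw [(FineFieldChart.family_uC _ k u z).2]
  show expChartInvT _ (towerB D ι u.ctr) (towerCoord _ ℰ ι u.ctr.1 u.dir z) = _
  rw [towerB_eq_towerDataOf D ι ℰ havB]
  exact expChartInvT_towerCoord ℰ ι hι _ _ z ((hctl _ u.ctr_mem _ u.dir_mem).window z hz)
    fun j hj c i => ((hctl _ u.ctr_mem _ u.dir_mem).loop_le hδ hz j hj c i).1.1

end Family

end Road

/-! ## §3 `G := SU(n)`, `ι := fundamentalRep n`, `ℰ := expMeanLogSU`: the real move and the discharged inhabitant -/

section SU

variable {P : Params} {n : Type} [Fintype n] [DecidableEq n] [Nonempty n]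

omit [DecidableEq n] [Nonempty n] in
/-- [folklore] `𝔰𝔲(n)` is closed under real scalings written through `ℂ`: `(x : ℂ) • X ∈ 𝔰𝔲(n)` for `X ∈ 𝔰𝔲(n)`, `x : ℝ`. -/
theorem smul_mem_lieSU {X : Matrix n n ℂ} (hX : X ∈ lieSU n) (x : ℝ) : (x : ℂ) • X ∈ lieSU n := by
  rw [mem_lieSU_iff] at hX ⊢
  refine ⟨?_, ?_⟩
  · rw [star_smul, hX.1, smul_neg, Complex.star_def, Complex.conj_ofReal]
  · rw [Matrix.trace_smul, hX.2, smul_zero]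

/-- [folklore] **THE REAL MOVE OF AN `SU(n)` FIELD ALONG AN `𝔰𝔲(n)`-VALUED DIRECTION**: `b ↦ exp(x·H b)·U b`, an `SU(n)` field again (tree
`exp_mem_specialUnitaryGroup_of_mem_lieSU`) — the real feet of the fine-field slice. -/
def moveSU (U : GaugeField P 0 (Matrix.specialUnitaryGroup n ℂ)) (H : PBond P 0 → Matrix n n ℂ) (hH : ∀ b, H b ∈ lieSU n) (x : ℝ) :
    GaugeField P 0 (Matrix.specialUnitaryGroup n ℂ) := fun b =>
  ⟨NormedSpace.exp ((x : ℂ) • H b), exp_mem_specialUnitaryGroup_of_mem_lieSU (smul_mem_lieSU (hH b) x)⟩ * U b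

omit [Nonempty n] in
/-- [folklore] The moved field on matrices (`rfl`). -/
theorem coe_moveSU (U : GaugeField P 0 (Matrix.specialUnitaryGroup n ℂ)) (H : PBond P 0 → Matrix n n ℂ) (hH : ∀ b, H b ∈ lieSU n) (x : ℝ)
    (b : PBond P 0) : (moveSU U H hH x b : Matrix n n ℂ) = NormedSpace.exp ((x : ℂ) • H b) * (U b : Matrix n n ℂ) := rfl

/-- [folklore] **THE `R`-SIDE OF THE SLICE AT A REAL PARAMETER IS `ι ∘ (moved field)`.** -/
theorem sliceR_moveSU (U : GaugeField P 0 (Matrix.specialUnitaryGroup n ℂ)) (H : PBond P 0 → Matrix n n ℂ) (hH : ∀ b, H b ∈ lieSU n) (x : ℝ) :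
    sliceR (fundamentalRep n) U H (x : ℂ) = fun b => fundamentalRep n (moveSU U H hH x b) :=
  funext fun b => by rw [fundamentalRep_apply, coe_moveSU]; rfl

/-- [folklore] **… AND THE `S`-SIDE IS `ι ∘ (moved field)⁻¹`** (uniqueness of two-sided inverses: α `sliceS_mul_sliceR` against `ι(U')·ι(U'⁻¹) = 1`). -/
theorem sliceS_moveSU (U : GaugeField P 0 (Matrix.specialUnitaryGroup n ℂ)) (H : PBond P 0 → Matrix n n ℂ) (hH : ∀ b, H b ∈ lieSU n) (x : ℝ) :
    sliceS (fundamentalRep n) U H (x : ℂ) = fun b => fundamentalRep n (moveSU U H hH x b)⁻¹ :=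
  funext fun b => by
    have h1 : sliceS (fundamentalRep n) U H (x : ℂ) b * fundamentalRep n (moveSU U H hH x b) = 1 := by
      rw [← congrFun (sliceR_moveSU U H hH x) b]; exact sliceS_mul_sliceR _ U H _ b
    have h2 : fundamentalRep n (moveSU U H hH x b) * fundamentalRep n (moveSU U H hH x b)⁻¹ = 1 := by
      rw [← map_mul, mul_inv_cancel, map_one]
    exact left_inv_eq_right_inv h1 h2

variable {D : DrivenRuns (Matrix.specialUnitaryGroup n ℂ)} {Wreg : Set D.carriers.BgB}
  {dirs : D.carriers.BgB → Set (PBond (D.F.P (D.K + 1)) 0 → Matrix n n ℂ)} {r : ℝ}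

/-- [folklore] **THE INHABITANT AT `SU(n)`, `ι := fundamentalRep n`, `ℰ := expMeanLogSU`** — every representation-side hypothesis of `ofSlices`
DISCHARGED (α `expMeanLogSU_δ_le_third`, tree `fundamentalRep_mem_unitaryGroup`, `rfl`, W-24b `fundamentalRep_expMeanLogSU_E`); admissible directions
`𝔰𝔲(n)`-valued (`hdirs`); the window's closure under the real moves `moveSU` (`hclosed`), its levelwise smallness and `SliceControl` DISPLAYED (FILE 2
discharges all three for the canonical small-field window of `DrivenRuns.balaban`). -/
def FineFieldChart.ofSlicesSU (havB : D.avB = fun _ => blockAvg (expMeanLogSU (n := n))) {ϱ : ℕ → D.carriers.BgB → ℝ}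
    (hWsmall : ∀ U ∈ Wreg, ∀ j < (D.F.P (D.K + 1)).K, ∀ c,
      Small (expMeanLogSU (n := n)) (Averaging.iter (fun _ => blockAvg (expMeanLogSU (n := n))) j U.1) c)
    (hctl : ∀ U ∈ Wreg, ∀ H ∈ dirs U, SliceControl (expMeanLogSU (n := n)) (fundamentalRep n) U.1 H (fun k => ϱ k U))
    (hdirs : ∀ U, ∀ H ∈ dirs U, ∀ b, H b ∈ lieSU n)
    (hclosed : ∀ U ∈ Wreg, ∀ H (hH : H ∈ dirs U), ∀ x : ℝ, |x| < 1 → ∃ U' ∈ Wreg, U'.1 = moveSU U.1 H (hdirs U H hH) x) :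
    FineFieldChart D (fundamentalRep n) Wreg (SlicePoint D Wreg dirs r) (SlicePoint.emb D (fundamentalRep n) (expMeanLogSU (n := n))) ϱ r :=
  FineFieldChart.ofSlices havB expMeanLogSU_δ_le_third (fun g => fundamentalRep_mem_unitaryGroup g) (fun _ => rfl)
    (fun W hW => fundamentalRep_expMeanLogSU_E W hW) hWsmall hctl fun U hU H hH x hx => by
      obtain ⟨U', hU', h⟩ := hclosed U hU H hH x hx
      exact ⟨U', hU', by rw [h]; exact sliceR_moveSU _ _ _ _, by rw [h]; exact sliceS_moveSU _ _ _ _⟩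

end SU

end Summit.QuantumFields.BalabanUV.T4Continuum.SubstrateFineFieldChartSU

end
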